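import Summits.BirchSwinnertonDyer.Rank1Residual.GaloisImage.FiniteSingularComparisonReduction
import Summits.BirchSwinnertonDyer.Rank1Residual.GaloisImage.KolyvaginPrimeLocalShape
import HarnessLib

/-!
# The canonical finite–singular comparison map is an isomorphism, VII: `Q₁(ψ)` maps onto
# `ker (ψ − 1)` over `ℤ/p^n` (reduction mod `p` + Nakayama; [MR04] Lemma 1.2.3, first map)
# (cell `b2b-bsdres`, team n1011, seat p11 gen 4, OWNERS row T-HCC-adm, sequel F2′; file 7)

HONEST FRAMING (cell `b2b-bsdres`, run/shared/lean/b2b/bsd-rank1-residual/, verbatim in every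
file): the goal of the cell is to DELETE the COMBINATION-SHAPED residual classes of the
Birch–Swinnerton-Dyer formula for ALL analytic-rank `≤ 1` elliptic curves over `ℚ` — "full BSD
formula for every rank `≤ 1` curve in class `C`" assembled STRICTLY from published theorems — so
that the rank-`≤ 1` remainder becomes exactly the CONSTRUCTION-SHAPED classes, which are TYPED
(missing-input `Prop`s), NOT attempted. This is not "finishing BSD". Team n1011 (N10 / N11, the
additive block X4 ∧ `p = 3`): research route on the CONSTRUCTION-SHAPED class X4; no claim beyond the
stated classes; nothing is booked. TOOL theorems of linear algebra; no definition, no named fact,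
no `sorry`.

## What is proved

`PrimePow.exists_aeval_divByMonic_charpoly_eq`: for an endomorphism `ψ` of a free `ℤ/p^n`-module
`M` of finite rank (`p` prime, `n ≥ 1`) with `M/(ψ − 1)M ≃ ℤ/p^n` and `χ_ψ(1) = 0`, the operator
`Q₁(ψ)`, `Q₁ = χ_ψ /ₘ (X − 1)`, maps ONTO `ker (ψ − 1)` — Mazur–Rubin, *Kolyvagin systems*,
Lemma 1.2.3 (proof: "Applying [the field] case to the `R/m`-module `T/mT` and using Nakayama's
Lemma we see that `Q(Fr⁻¹)` is surjective").  Reduction modulo `p` is done through a basis: `π`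
sends `m` to its coordinates mod `p` in `V = 𝔽_p^ι`, on which `ψ` becomes the reduced matrix `Ḡ`
(`π ∘ ψ = Ḡ ∘ π`, `ker π = pM`, `χ_Ḡ = χ_ψ mod p` by Mathlib `Matrix.charpoly_map`, and
`#coker (Ḡ − 1) = #(ℤ/p^n / p·ℤ/p^n) = p`); file 1 (`range_aeval_divByMonic_charpoly_eq_ker`) gives
the field case; the lift uses file 6's `D ∩ pM = pD` (`PrimePow.mem_smul_of_mem_ker_of_smul`) `n`
times.

References: B. Mazur, K. Rubin, Mem. AMS 799 (2004), Lemma 1.2.3 (pp. 10–11); K. Rubin, PCMI 18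
(2011), Ex. 1.9.7.
-/

noncomputable section

open Polynomial Module
open scoped Matrix

namespace Summit.BirchSwinnertonDyer.Rank1Residual.GaloisImage.FSComp.PrimePow

variable {p n : ℕ} [hp : Fact p.Prime] [NeZero n]
variable {M : Type*} [AddCommGroup M] [Module (ZMod (p ^ n)) M] [Module.Free (ZMod (p ^ n)) M]
  [Module.Finite (ZMod (p ^ n)) M]
variable (ψ : Module.End (ZMod (p ^ n)) M)

/-- **`Q₁(ψ)` maps onto `ker (ψ − 1)` over `ℤ/p^n`** ([MR04] Lemma 1.2.3, first map, via reduction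
mod `p`, the field case of file 1, and the Nakayama step of file 6).
[cite: MazurRubin2004, Lemma 1.2.3 (p. 10–11)] [cite: Rubin2011, Exercise 1.9.7 (p. 15)] -/
theorem exists_aeval_divByMonic_charpoly_eq
    (hcok : Nonempty ((M ⧸ (LinearMap.range (ψ - 1)).toAddSubgroup) ≃+ ZMod (p ^ n)))
    (h1 : ψ.charpoly.IsRoot 1) (a : M) (ha : ψ a = a) :
    ∃ m : M, aeval ψ (ψ.charpoly /ₘ (X - C 1)) m = a := by
  classical
  haveI : NeZero (p ^ n) := ⟨pow_ne_zero _ hp.out.ne_zero⟩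
  have hpn : p ∣ p ^ n := dvd_pow_self p (NeZero.ne n)
  let c : ZMod (p ^ n) →+* ZMod p := ZMod.castHom hpn (ZMod p)
  let b := Module.Free.chooseBasis (ZMod (p ^ n)) M
  set G : Matrix (Module.Free.ChooseBasisIndex (ZMod (p ^ n)) M)
      (Module.Free.ChooseBasisIndex (ZMod (p ^ n)) M) (ZMod (p ^ n)) :=
    LinearMap.toMatrix b b ψ with hG
  set f : Module.End (ZMod p) (Module.Free.ChooseBasisIndex (ZMod (p ^ n)) M → ZMod p) :=
    Matrix.toLin' (G.map c) with hf
  set Q₁ := ψ.charpoly /ₘ (X - C 1) with hQ₁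
  set R₁ := (LinearMap.range (ψ - 1)).toAddSubgroup with hR₁
  have hmemR₁ : ∀ y, y ∈ R₁ ↔ ∃ z, ψ z - z = y := fun y => by
    rw [hR₁, Submodule.mem_toAddSubgroup, LinearMap.mem_range]
    simp only [LinearMap.sub_apply, Module.End.one_apply]
  -- the reduction map `π : m ↦ (coordinates of m mod p)`
  let π : M →+ (Module.Free.ChooseBasisIndex (ZMod (p ^ n)) M → ZMod p) :=
    { toFun := fun m i => c (b.repr m i)
      map_zero' := by ext i; simp
      map_add' := fun x y => by ext i; simp }
  have hπ : ∀ m i, π m i = c (b.repr m i) := fun _ _ => rfl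
  have hnat : ∀ (k : ℕ) (m : M), (k : ZMod (p ^ n)) • m = k • m := fun k m =>
    Nat.cast_smul_eq_nsmul _ k m
  -- (a) `π ∘ ψ = f ∘ π`
  have hπψ : ∀ m, π (ψ m) = f (π m) := fun m => by
    ext i
    rw [hπ, hf, Matrix.toLin'_apply]
    have hr : (b.repr (ψ m) : _ → ZMod (p ^ n)) = G *ᵥ (b.repr m : _ → ZMod (p ^ n)) := by
      rw [hG, LinearMap.toMatrix_mulVec_repr]
    rw [show b.repr (ψ m) i = (G *ᵥ ⇑(b.repr m)) i by rw [hr], RingHom.map_mulVec]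
    rfl
  have hπsmul : ∀ (r : ZMod (p ^ n)) (m : M), π (r • m) = c r • π m := fun r m => by
    ext i
    rw [hπ, Pi.smul_apply, hπ, map_smul, Finsupp.smul_apply, smul_eq_mul, smul_eq_mul, map_mul]
  have hπpow : ∀ (k : ℕ) (m : M), π ((ψ ^ k) m) = (f ^ k) (π m) := by
    intro k
    induction k with
    | zero => intro m; rw [pow_zero, pow_zero, Module.End.one_apply, Module.End.one_apply]
    | succ k ih =>
      intro m
      rw [pow_succ', Module.End.mul_apply, hπψ, ih, pow_succ', Module.End.mul_apply]
  have hπaeval : ∀ (q : (ZMod (p ^ n))[X]) (m : M), π (aeval ψ q m) = aeval f (q.map c) (π m) := by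
    intro q
    induction q using Polynomial.induction_on' with
    | add q₁ q₂ h₁ h₂ =>
      intro m
      rw [map_add, LinearMap.add_apply, map_add, h₁, h₂, Polynomial.map_add, map_add,
        LinearMap.add_apply]
    | monomial k r =>
      intro m
      rw [Polynomial.map_monomial, aeval_monomial, aeval_monomial, Module.End.mul_apply,
        Module.algebraMap_end_apply, hπsmul, hπpow, Module.End.mul_apply, Module.algebraMap_end_apply]
  -- (b) `ker π = pM`
  have hπker : ∀ m, π m = 0 → ∃ m', m = (p : ZMod (p ^ n)) • m' := by
    intro m hm
    have hci : ∀ i, ∃ d, b.repr m i = (p : ZMod (p ^ n)) * d := fun i => by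
      have h0 : c (b.repr m i) = 0 := by rw [← hπ, hm]; rfl
      have hx : b.repr m i = ((b.repr m i).val : ZMod (p ^ n)) := (ZMod.natCast_zmod_val _).symm
      rw [hx, map_natCast, ZMod.natCast_eq_zero_iff] at h0
      obtain ⟨d, hd⟩ := h0
      exact ⟨d, by rw [hx, hd, Nat.cast_mul]⟩
    choose d hd using hci
    refine ⟨∑ i, d i • b i, ?_⟩
    rw [Finset.smul_sum]
    conv_lhs => rw [← b.sum_repr m]
    exact Finset.sum_congr rfl fun i _ => by rw [hd i, smul_smul]
  -- (c) `π` is onto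
  have hπsurj : Function.Surjective π := fun v => by
    choose l hl using fun i => ZMod.ringHom_surjective c (v i)
    refine ⟨b.equivFun.symm l, ?_⟩
    ext i
    rw [hπ, ← Basis.equivFun_apply, LinearEquiv.apply_symm_apply, hl]
  -- (d) the characteristic polynomial reduces
  have hχ : f.charpoly = ψ.charpoly.map c := by
    have hfm : LinearMap.toMatrix' f = G.map c := by rw [hf, LinearMap.toMatrix'_toLin']
    calc f.charpoly
        = (LinearMap.toMatrix (Pi.basisFun (ZMod p) _) (Pi.basisFun (ZMod p) _) f).charpoly :=
          (LinearMap.charpoly_toMatrix f _).symm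
      _ = (G.map c).charpoly := by rw [LinearMap.toMatrix_eq_toMatrix', hfm]
      _ = G.charpoly.map c := Matrix.charpoly_map G c
      _ = ψ.charpoly.map c := by rw [hG, LinearMap.charpoly_toMatrix ψ b]
  have hQmap : f.charpoly /ₘ (X - C 1) = Q₁.map c := by
    rw [hχ, hQ₁, Polynomial.map_divByMonic c (monic_X_sub_C (1 : ZMod (p ^ n)))]
    simp only [Polynomial.map_sub, Polynomial.map_X, Polynomial.map_one, map_one]
  -- (e) `dim ker (f - 1) = 1` by counting the cokernel through `π`
  set δ : (Module.Free.ChooseBasisIndex (ZMod (p ^ n)) M → ZMod p) →+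
      (Module.Free.ChooseBasisIndex (ZMod (p ^ n)) M → ZMod p) := (f - 1).toAddMonoidHom with hδ
  set θ : M →+ _ ⧸ δ.range := (QuotientAddGroup.mk' δ.range).comp π with hθ
  have hθapp : ∀ m, θ m = QuotientAddGroup.mk (π m) := fun _ => rfl
  have hθsurj : Function.Surjective θ := fun y => by
    obtain ⟨v, rfl⟩ := QuotientAddGroup.mk_surjective y
    obtain ⟨m, rfl⟩ := hπsurj v
    exact ⟨m, hθapp m⟩
  obtain ⟨e⟩ := hcok
  -- `R₁ ≤ ker θ`
  have hR₁K : R₁ ≤ θ.ker := by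
    intro y hy
    obtain ⟨z, rfl⟩ := (hmemR₁ y).mp hy
    rw [AddMonoidHom.mem_ker, hθapp, QuotientAddGroup.eq_zero_iff, map_sub, hπψ]
    exact ⟨π z, by rw [hδ, LinearMap.toAddMonoidHom_coe, LinearMap.sub_apply, Module.End.one_apply]⟩
  -- the image of `ker θ` in `ℤ/p^n` is `p·ℤ/p^n`
  set Kbar : AddSubgroup (M ⧸ R₁) := θ.ker.map (QuotientAddGroup.mk' R₁) with hKbar
  have hKbar_e : Kbar.map e.toAddMonoidHom = AddSubgroup.zmultiples (p : ZMod (p ^ n)) := by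
    apply le_antisymm
    · rintro y ⟨kb, hkb, rfl⟩
      obtain ⟨k, hk, rfl⟩ := AddSubgroup.mem_map.mp hkb
      rw [AddMonoidHom.mem_ker, hθapp, QuotientAddGroup.eq_zero_iff] at hk
      obtain ⟨v, hv⟩ := hk
      obtain ⟨m₁, rfl⟩ := hπsurj v
      have h0 : π (k - (ψ m₁ - m₁)) = 0 := by
        rw [map_sub, map_sub, hπψ, ← hv, hδ, LinearMap.toAddMonoidHom_coe, LinearMap.sub_apply,
          Module.End.one_apply, sub_self]
      obtain ⟨m₂, hm₂⟩ := hπker _ h0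
      have hk' : (QuotientAddGroup.mk' R₁ k : M ⧸ R₁) = p • QuotientAddGroup.mk m₂ := by
        rw [QuotientAddGroup.mk'_apply, ← QuotientAddGroup.mk_nsmul, ← hnat, ← hm₂, eq_comm,
          QuotientAddGroup.mk_sub, sub_eq_self, QuotientAddGroup.eq_zero_iff, hmemR₁]
        exact ⟨m₁, rfl⟩
      rw [AddSubgroup.mem_zmultiples_iff]
      refine ⟨((e (QuotientAddGroup.mk m₂)).val : ℤ), ?_⟩
      change _ = e (QuotientAddGroup.mk' R₁ k)
      rw [hk', map_nsmul, nsmul_eq_mul, zsmul_eq_mul, Int.cast_natCast, ZMod.natCast_zmod_val,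
        mul_comm]
    · intro y hy
      rw [AddSubgroup.mem_zmultiples_iff] at hy
      obtain ⟨k, rfl⟩ := hy
      obtain ⟨zbar, hz⟩ := e.surjective (k : ZMod (p ^ n))
      obtain ⟨m₃, rfl⟩ := QuotientAddGroup.mk_surjective zbar
      refine ⟨QuotientAddGroup.mk' R₁ ((p : ZMod (p ^ n)) • m₃), ?_, ?_⟩
      · refine AddSubgroup.mem_map.mpr ⟨(p : ZMod (p ^ n)) • m₃, ?_, rfl⟩
        rw [AddMonoidHom.mem_ker, hθapp, hπsmul,
          show c (p : ZMod (p ^ n)) = 0 by rw [map_natCast, ZMod.natCast_self], zero_smul,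
          QuotientAddGroup.mk_zero]
      · change e (QuotientAddGroup.mk ((p : ZMod (p ^ n)) • m₃)) = k • (p : ZMod (p ^ n))
        rw [hnat, QuotientAddGroup.mk_nsmul, map_nsmul, hz, nsmul_eq_mul, zsmul_eq_mul, mul_comm]
  have hcardKbar : Nat.card Kbar = p ^ (n - 1) := by
    rw [Nat.card_congr (Kbar.equivMapOfInjective e.toAddMonoidHom e.injective).toEquiv, hKbar_e,
      natCard_zmultiples_natCast (NeZero.ne n)]
  -- `#(M ⧸ ker θ) = p`
  have hcardQ : Nat.card (M ⧸ θ.ker) = p := by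
    have h3 := Nat.card_congr
      (QuotientAddGroup.quotientQuotientEquivQuotient R₁ θ.ker hR₁K).toEquiv
    have hL := AddSubgroup.card_eq_card_quotient_mul_card_addSubgroup Kbar
    rw [Nat.card_congr e.toEquiv, Nat.card_zmod, h3, hcardKbar] at hL
    have hpn' : p ^ n = p * p ^ (n - 1) := by
      rw [← pow_succ', Nat.sub_add_cancel (Nat.one_le_iff_ne_zero.mpr (NeZero.ne n))]
    have hL' : Nat.card (M ⧸ θ.ker) * p ^ (n - 1) = p * p ^ (n - 1) := hL.symm.trans hpn'
    exact Nat.eq_of_mul_eq_mul_right (pow_pos hp.out.pos _) hL'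
  have hfin1 : finrank (ZMod p) (LinearMap.ker (f - 1)) = 1 := by
    have hcard : Nat.card (LinearMap.ker (f - 1)) = p := by
      have h := natCard_ker_eq_natCard_quotient_range δ
      rw [← Nat.card_congr (QuotientAddGroup.quotientKerEquivOfSurjective θ hθsurj).toEquiv,
        hcardQ] at h
      have hkk : Nat.card (LinearMap.ker (f - 1)) = Nat.card δ.ker :=
        Nat.card_congr (Equiv.subtypeEquivRight fun v => Iff.rfl)
      rw [hkk, h]
    have h := Module.natCard_eq_pow_finrank (K := ZMod p) (V := LinearMap.ker (f - 1))
    rw [hcard, Nat.card_zmod] at h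
    have h' : p ^ 1 = p ^ finrank (ZMod p) (LinearMap.ker (f - 1)) := by rw [pow_one]; exact h
    exact (Nat.pow_right_injective hp.out.two_le h').symm
  -- (f) the field case on `V`
  have hrange : LinearMap.range (aeval f (Q₁.map c)) = LinearMap.ker (f - 1) := by
    rw [← hQmap]; exact range_aeval_divByMonic_charpoly_eq_ker f hfin1
  -- (g) Cayley–Hamilton: `Q₁(ψ)` lands in `ker (ψ − 1)`
  have hCH : ∀ m, ψ (aeval ψ Q₁ m) = aeval ψ Q₁ m := fun m => by
    have hmul : (X - C (1 : ZMod (p ^ n))) * Q₁ = ψ.charpoly := mul_divByMonic_eq_iff_isRoot.mpr h1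
    have h := LinearMap.congr_fun (congrArg (aeval ψ) hmul) m
    rw [map_mul, Module.End.mul_apply, LinearMap.aeval_self_charpoly, LinearMap.zero_apply, map_sub,
      aeval_X, aeval_C, map_one, LinearMap.sub_apply, Module.End.one_apply, sub_eq_zero] at h
    exact h
  -- (h) one Nakayama step: `a ∈ D ⟹ a ≡ Q₁(ψ) m (mod pD)`
  have step : ∀ a', ψ a' = a' → ∃ m a'', ψ a'' = a'' ∧ a' = aeval ψ Q₁ m + (p : ZMod (p ^ n)) • a'' := by
    intro a' ha'
    have hmem : π a' ∈ LinearMap.ker (f - 1) := by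
      rw [LinearMap.mem_ker, LinearMap.sub_apply, Module.End.one_apply, ← hπψ, ha', sub_self]
    rw [← hrange] at hmem
    obtain ⟨v, hv⟩ := hmem
    obtain ⟨m, rfl⟩ := hπsurj v
    have h0 : π (a' - aeval ψ Q₁ m) = 0 := by rw [map_sub, hπaeval, hv, sub_self]
    obtain ⟨x, hx⟩ := hπker _ h0
    have hfix : ψ (a' - aeval ψ Q₁ m) = a' - aeval ψ Q₁ m := by rw [map_sub, ha', hCH]
    obtain ⟨d', hd'fix, hd'⟩ := mem_smul_of_mem_ker_of_smul ψ ⟨e⟩ hfix hx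
    exact ⟨m, d', hd'fix, by rw [← hd', add_sub_cancel]⟩
  -- (i) iterate
  have iter : ∀ j : ℕ, ∀ a', ψ a' = a' →
      ∃ m a'', ψ a'' = a'' ∧ a' = aeval ψ Q₁ m + (p : ZMod (p ^ n)) ^ j • a'' := by
    intro j
    induction j with
    | zero => intro a' ha'; exact ⟨0, a', ha', by rw [map_zero, zero_add, pow_zero, one_smul]⟩
    | succ j ih =>
      intro a' ha'
      obtain ⟨m, a'', ha'', h⟩ := ih a' ha'
      obtain ⟨m', a''', ha''', h'⟩ := step a'' ha''
      refine ⟨m + (p : ZMod (p ^ n)) ^ j • m', a''', ha''', ?_⟩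
      rw [h, h', map_add, map_smul, smul_add, smul_smul, ← pow_succ]
      abel
  obtain ⟨m, a'', -, h⟩ := iter n a ha
  refine ⟨m, ?_⟩
  rw [h, ← Nat.cast_pow, ZMod.natCast_self, zero_smul, add_zero]

end Summit.BirchSwinnertonDyer.Rank1Residual.GaloisImage.FSComp.PrimePow

end
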